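import Summits.BirchSwinnertonDyer.BirchSwinnertonDyer.Theorems.GenusKolyvaginAtTwoTorsionCellD0ParityPairing
import Summits.BirchSwinnertonDyer.BirchSwinnertonDyer.Theorems.GenusKolyvaginAtTwoTorsionCellD0ParityFrame
import Summits.BirchSwinnertonDyer.BirchSwinnertonDyer.Theorems.GenusKolyvaginAtTwoTorsionCellD0ParityLocal
import Summits.BirchSwinnertonDyer.BirchSwinnertonDyer.Theorems.GenusKolyvaginAtTwoTorsionCellD0ParityCount
import Literature.LinearAlgebra.QuadraticForm.DualProdLagrangianParity
import HarnessLib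

/-!
# D0≤2, the genus twist `E₀^{(−p₀q₁q₂)}` has `#Sel⁽²⁾ = 8` UNCONDITIONALLY (Klagsbrun–Mazur–Rubin parity, explicit)

Crux R″ `RankOneTwoTorsionResidualAtTwo` (stmt-27478), LINE 49 «full_vertex», stub D0≤2, slice `#Q₀ = 2`.
`…D0TripleTwistBound` proved `#Sel⁽²⁾(E₀^{(d)}) ∈ {4, 8}` (`d = −p₀q₁q₂`); `…D0TripleTwistEight` settled `= 8` on the
half `(q₁q₂/p₀) = +1` by an explicit class; in print the other half is `2`-PARITY (Cassels–Tate / root numbers).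
Here the parity is PROVED following [KlagsbrunMazurRubin2013, Thm. 3.9] with every ingredient explicit: the quadratic
space is the standard metabolic `N* × N`, `N = (ℤ/2)⁷` = E's local conditions at `∞, p, q₁, q₂` in bit coordinates,
`N*` = those of `E^{(d)}` (the `I₀*` relations); the relaxed Selmer group `R` maps into it by the bits of the
components (`β`), its image `Z` is totally isotropic because the pairing is the Hilbert-symbol Tate form, which sums
to `0` by Hilbert reciprocity (`…ParityLocal`), and `dim Z = 7` by a COUNT (`…ParityCount`, replacing Poitou–Tate)
plus injectivity of `β` on `R`; `Z ∩ (N* × 0) ≅ Sel⁽²⁾(E)`, `Z ∩ (0 × N) ≅ Sel⁽²⁾(E^{(d)})` (`…ParityFrame`), so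
KMR Prop. 2.4 (`even_finrank_inf_add_finrank_inf_add_of_dualProd`) gives `dim Sel⁽²⁾(E^{(d)}) ≡ 2 + 7`: odd, `= 3`.
Everything is proved; no LINE 49 statement is restated; BSD is not advanced by this file alone.
References: [KlagsbrunMazurRubin2013] Ann. of Math. 178 (2013), Prop. 2.4, Thm. 3.9; [Kramer1981] Trans. AMS 264,
Thm. 1; [SilvermanAEC2009] Prop. X.1.4, X.4.9.
-/

noncomputable section

open scoped Classical

namespace Summit.BirchSwinnertonDyer.BirchSwinnertonDyer.Theorems.GenusKolyvaginAtTwo.TorsionCellD0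

open WeierstrassCurve WeierstrassCurve.Affine WeierstrassCurve.Affine.Point
open Literature.NumberTheory.GaloisRepresentations Literature.NumberTheory.EllipticCurves Field
open Literature.NumberTheory.EllipticCurves.TwoDescentLocal
open Literature.NumberTheory.EllipticCurves.KramerTwoDescent
open Literature.NumberTheory.QuadraticForms Literature.LinearAlgebra.QuadraticForm
open IsDedekindDomain NumberField Rat.HeightOneSpectrum Module

variable (E : WeierstrassCurve ℚ) [E.IsElliptic] {e₁ e₂ e₃ : ℚ}
variable (S : Finset ℕ) {p q₁ q₂ : ℕ} [hp : Fact p.Prime] [hq₁ : Fact q₁.Prime] [hq₂ : Fact q₂.Prime]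

/-- **`#Sel⁽²⁾(E₀^{(−p₀q₁q₂)}) = 8`, unconditionally** (setting and hypotheses of
`natCard_selmerGroup_twist_triple_eq_four_or_eight`): the `2`-parity `dim Sel⁽²⁾(E^{(d)}) ≡ dim Sel⁽²⁾(E) + 7`
of Klagsbrun–Mazur–Rubin / Kramer, proved here by Hilbert reciprocity, local counts and KMR Prop. 2.4, excludes `4`.
[cite: KlagsbrunMazurRubin2013, Prop. 2.4, Thm. 3.9] [cite: Kramer1981, Thm. 1] [cite: SilvermanAEC2009, Prop. X.4.9] -/
theorem natCard_selmerGroup_twist_triple_eq_eight (h : E.toAffine.SplitTwoTorsion e₁ e₂ e₃) (hS : ∀ q ∈ S, q.Prime)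
    (h2S : 2 ∈ S) (h12 : e₁ < e₂) (h23 : e₂ < e₃)
    (hgood : ∀ ℓ : ℕ, (hℓ : ℓ.Prime) → ℓ ∉ S → haveI : Fact ℓ.Prime := ⟨hℓ⟩;
      padicValRat ℓ (e₁ - e₂) = 0 ∧ padicValRat ℓ (e₁ - e₃) = 0 ∧ padicValRat ℓ (e₂ - e₃) = 0)
    (hN : ∀ ℓ : ℕ, ℓ.Prime → ℓ ∉ S → ¬ ℓ ∣ E.conductorNorm ℤ)
    (hrank : E.mordellWeilRank = 0) (hsha : ∀ x ∈ E.sha, 2 • x = 0 → x = 0)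
    (hpS : p ∉ S) (hq₁S : q₁ ∉ S) (hq₂S : q₂ ∉ S) (hpq₁ : p ≠ q₁) (hpq₂ : p ≠ q₂) (hne : q₁ ≠ q₂)
    (hp8 : p % 8 = 7) (hq₁4 : q₁ % 4 = 3) (hq₂4 : q₂ % 4 = 3) (hM8 : ((q₁ : ℤ) * q₂) % 8 = 1)
    (hsplitp : ∀ ℓ ∈ S, (hℓ : ℓ.Prime) → ℓ ≠ 2 → haveI : Fact ℓ.Prime := ⟨hℓ⟩; legendreSym ℓ (-(p : ℤ)) = 1)
    (hsplitM : ∀ ℓ ∈ S, (hℓ : ℓ.Prime) → ℓ ≠ 2 → haveI : Fact ℓ.Prime := ⟨hℓ⟩; legendreSym ℓ ((q₁ : ℤ) * q₂) = 1)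
    (hδ₁₁ : qrBit q₁ ((e₁ - e₂) * (e₁ - e₃)) = 1) (hδ₂₁ : qrBit q₁ ((e₂ - e₁) * (e₂ - e₃)) = 1)
    (hδ₁₂ : qrBit q₂ ((e₁ - e₂) * (e₁ - e₃)) = 1) (hδ₂₂ : qrBit q₂ ((e₂ - e₁) * (e₂ - e₃)) = 1)
    (ht : qrBit q₂ (e₂ - e₁) = qrBit q₁ (e₂ - e₁))
    {d : ℚ} (hd : d = -(p : ℚ) * ((q₁ : ℚ) * q₂)) [(E.quadraticTwist d).IsElliptic] :
    Nat.card (selmerGroup (E.quadraticTwist d) 2) = 8 := by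
  rcases natCard_selmerGroup_twist_triple_eq_four_or_eight E S h hS h2S h12 h23 hgood hN hrank hsha hpS hq₁S hq₂S hpq₁
    hpq₂ hne hp8 hq₁4 hq₂4 hM8 hsplitp hsplitM hδ₁₁ hδ₂₁ hδ₁₂ hδ₂₂ ht hd with h4 | h8
  swap
  · exact h8
  exfalso
  have hp4 : p % 4 = 3 := by omega
  have h' := h.quadraticTwist d
  /- ### the frame: components, bit homomorphisms, `β : H¹(ℚ, E[2]) → N* × N` -/
  let χ₁ : galH1Torsion E 2 →+ Additive (SqUnits ℚ) := (kummerEquiv ℚ 2).toAddMonoidHom.comp (E.twoTorsionCharH1 h)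
  let χ₂ : galH1Torsion E 2 →+ Additive (SqUnits ℚ) :=
    (kummerEquiv ℚ 2).toAddMonoidHom.comp (E.twoTorsionCharH1 h.swap₁₂)
  -- E's coordinates `α_q = v_q(a)`, `β_q = v_q(b)`; E^{(d)}'s coordinates `f₁, f₂` (the `I₀*` relations)
  let A : ∀ (q : ℕ) [Fact q.Prime], galH1Torsion E 2 →+ ZMod 2 := fun q _ => (parityHom q).comp χ₁
  let B : ∀ (q : ℕ) [Fact q.Prime], galH1Torsion E 2 →+ ZMod 2 := fun q _ => (parityHom q).comp χ₂
  let F₁ : ∀ (q : ℕ) [Fact q.Prime], galH1Torsion E 2 →+ ZMod 2 := fun q _ =>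
    (qrHom q).comp χ₁ + (qrBit q d + qrBit q (e₂ - e₁)).val • (parityHom q).comp χ₁ +
      (qrBit q ((e₁ - e₂) * (e₁ - e₃))).val • (parityHom q).comp χ₂
  let F₂ : ∀ (q : ℕ) [Fact q.Prime], galH1Torsion E 2 →+ ZMod 2 := fun q _ =>
    (qrHom q).comp χ₂ + (qrBit q ((e₂ - e₁) * (e₂ - e₃))).val • (parityHom q).comp χ₁ +
      (qrBit q d + qrBit q (e₁ - e₂)).val • (parityHom q).comp χ₂
  let nVec : Fin 7 → (galH1Torsion E 2 →+ ZMod 2) :=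
    ![KramerTwoDescent.signHom.comp χ₁, B p, A p, B q₁, A q₁, B q₂, A q₂]
  let cVec : Fin 7 → (galH1Torsion E 2 →+ ZMod 2) :=
    ![KramerTwoDescent.signHom.comp χ₁ + KramerTwoDescent.signHom.comp χ₂, F₁ p, F₂ p, F₁ q₁, F₂ q₁, F₁ q₂, F₂ q₂]
  let N := Fin 7 → ZMod 2
  let nPart : galH1Torsion E 2 →+ N := AddMonoidHom.pi nVec
  let cPart : galH1Torsion E 2 →+ N := AddMonoidHom.pi cVec
  let toD : N →+ Module.Dual (ZMod 2) N := (Pi.basisFun (ZMod 2) (Fin 7)).toDual.toAddMonoidHom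
  let β : galH1Torsion E 2 →+ Module.Dual (ZMod 2) N × N := (toD.comp cPart).prod nPart
  have hβ1 : ∀ x, (β x).1 = toD (cPart x) := fun x => rfl
  have hβ2 : ∀ x, (β x).2 = nPart x := fun x => rfl
  have htoD_inj : Function.Injective toD := (Pi.basisFun (ZMod 2) (Fin 7)).toDual_injective
  have hcomp : ∀ x : galH1Torsion E 2, ∃ ab : ℚˣ × ℚˣ, kummerEquiv ℚ 2 (E.twoTorsionCharH1 h x) =
      Additive.ofMul (QuotientGroup.mk ab.1) ∧
      kummerEquiv ℚ 2 (E.twoTorsionCharH1 h.swap₁₂ x) = Additive.ofMul (QuotientGroup.mk ab.2) := fun x => by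
    obtain ⟨a, b, ha, hb⟩ := E.exists_kummerEquiv_twoTorsionCharH1_pair_eq h x
    exact ⟨(a, b), ha, hb⟩
  choose comp hcomp1 hcomp2 using hcomp
  have hA : ∀ (q : ℕ) [Fact q.Prime] (x : galH1Torsion E 2), A q x = parityBit q ((comp x).1 : ℚ) :=
    fun q _ x => E.parityHom_kummerEquiv_eq_parityBit h q (hcomp1 x)
  have hB : ∀ (q : ℕ) [Fact q.Prime] (x : galH1Torsion E 2), B q x = parityBit q ((comp x).2 : ℚ) :=
    fun q _ x => E.parityHom_kummerEquiv_eq_parityBit h.swap₁₂ q (hcomp2 x)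
  have hS₁ : ∀ x : galH1Torsion E 2, (KramerTwoDescent.signHom.comp χ₁) x = signBit ((comp x).1 : ℚ) :=
    fun x => E.signHom_kummerEquiv_eq_signBit h.swap₁₂ (hcomp1 x)
  have hS₂ : ∀ x : galH1Torsion E 2, (KramerTwoDescent.signHom.comp χ₂) x = signBit ((comp x).2 : ℚ) :=
    fun x => E.signHom_kummerEquiv_eq_signBit h (hcomp2 x)
  have hSS : ∀ x : galH1Torsion E 2, (KramerTwoDescent.signHom.comp χ₁ + KramerTwoDescent.signHom.comp χ₂) x =
      signBit ((comp x).1 : ℚ) + signBit ((comp x).2 : ℚ) := fun x => by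
    rw [AddMonoidHom.add_apply, hS₁, hS₂]
  have hQ₁ : ∀ (q : ℕ) [Fact q.Prime] (x : galH1Torsion E 2), qrHom q (χ₁ x) = qrBit q ((comp x).1 : ℚ) :=
    fun q _ x => E.qrHom_kummerEquiv_eq_qrBit h q (hcomp1 x)
  have hQ₂ : ∀ (q : ℕ) [Fact q.Prime] (x : galH1Torsion E 2), qrHom q (χ₂ x) = qrBit q ((comp x).2 : ℚ) :=
    fun q _ x => E.qrHom_kummerEquiv_eq_qrBit h.swap₁₂ q (hcomp2 x)
  have hP₁ : ∀ (q : ℕ) [Fact q.Prime] (x : galH1Torsion E 2), parityHom q (χ₁ x) = parityBit q ((comp x).1 : ℚ) :=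
    fun q _ x => E.parityHom_kummerEquiv_eq_parityBit h q (hcomp1 x)
  have hP₂ : ∀ (q : ℕ) [Fact q.Prime] (x : galH1Torsion E 2), parityHom q (χ₂ x) = parityBit q ((comp x).2 : ℚ) :=
    fun q _ x => E.parityHom_kummerEquiv_eq_parityBit h.swap₁₂ q (hcomp2 x)
  have hF₁ : ∀ (q : ℕ) [Fact q.Prime] (x : galH1Torsion E 2), F₁ q x = qrBit q ((comp x).1 : ℚ) +
      (qrBit q d + qrBit q (e₂ - e₁)) * parityBit q ((comp x).1 : ℚ) +
      qrBit q ((e₁ - e₂) * (e₁ - e₃)) * parityBit q ((comp x).2 : ℚ) := by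
    intro q _ x
    show (qrHom q) (χ₁ x) + (qrBit q d + qrBit q (e₂ - e₁)).val • (parityHom q) (χ₁ x) +
      (qrBit q ((e₁ - e₂) * (e₁ - e₃))).val • (parityHom q) (χ₂ x) = _
    rw [nsmul_eq_mul, nsmul_eq_mul, ZMod.natCast_zmod_val, ZMod.natCast_zmod_val, hQ₁, hP₁, hP₂]
  have hF₂ : ∀ (q : ℕ) [Fact q.Prime] (x : galH1Torsion E 2), F₂ q x = qrBit q ((comp x).2 : ℚ) +
      qrBit q ((e₂ - e₁) * (e₂ - e₃)) * parityBit q ((comp x).1 : ℚ) +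
      (qrBit q d + qrBit q (e₁ - e₂)) * parityBit q ((comp x).2 : ℚ) := by
    intro q _ x
    show (qrHom q) (χ₂ x) + (qrBit q ((e₂ - e₁) * (e₂ - e₃))).val • (parityHom q) (χ₁ x) +
      (qrBit q d + qrBit q (e₁ - e₂)).val • (parityHom q) (χ₂ x) = _
    rw [nsmul_eq_mul, nsmul_eq_mul, ZMod.natCast_zmod_val, ZMod.natCast_zmod_val, hQ₂, hP₁, hP₂]
  /- ### the relaxed group `R` and its image `Z` -/
  let R : AddSubgroup (galH1Torsion E 2) :=
    { carrier := {x | (∀ ℓ : ℕ, (hℓ : ℓ.Prime) → ℓ ∉ S → ℓ ≠ p → ℓ ≠ q₁ → ℓ ≠ q₂ → haveI : Fact ℓ.Prime := ⟨hℓ⟩;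
          parityHom ℓ (χ₁ x) = 0 ∧ parityHom ℓ (χ₂ x) = 0) ∧
        ∀ v : HeightOneSpectrum (𝓞 ℚ), natGenerator v ∈ S → x ∈ selmerLocalKer E (v.adicCompletion ℚ) 2}
      zero_mem' := ⟨fun ℓ hℓ _ _ _ _ => by simp only [_root_.map_zero, and_self], fun v _ => zero_mem _⟩
      add_mem' := fun {x y} hx hy => ⟨fun ℓ hℓ h1 h2 h3 h4 => by
          haveI : Fact ℓ.Prime := ⟨hℓ⟩
          obtain ⟨a1, a2⟩ := hx.1 ℓ hℓ h1 h2 h3 h4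
          obtain ⟨b1, b2⟩ := hy.1 ℓ hℓ h1 h2 h3 h4
          simp only [_root_.map_add, a1, b1, a2, b2, add_zero, and_self],
        fun v hv => add_mem (hx.2 v hv) (hy.2 v hv)⟩
      neg_mem' := fun {x} hx => ⟨fun ℓ hℓ h1 h2 h3 h4 => by
          haveI : Fact ℓ.Prime := ⟨hℓ⟩
          obtain ⟨a1, a2⟩ := hx.1 ℓ hℓ h1 h2 h3 h4
          simp only [_root_.map_neg, a1, a2, _root_.neg_zero, and_self],
        fun v hv => neg_mem (hx.2 v hv)⟩ }
  have hmemR : ∀ x : galH1Torsion E 2, x ∈ R ↔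
      (∀ ℓ : ℕ, (hℓ : ℓ.Prime) → ℓ ∉ S → ℓ ≠ p → ℓ ≠ q₁ → ℓ ≠ q₂ → haveI : Fact ℓ.Prime := ⟨hℓ⟩;
          parityBit ℓ ((comp x).1 : ℚ) = 0 ∧ parityBit ℓ ((comp x).2 : ℚ) = 0) ∧
        ∀ v : HeightOneSpectrum (𝓞 ℚ), natGenerator v ∈ S → x ∈ selmerLocalKer E (v.adicCompletion ℚ) 2 := by
    intro x
    show ((∀ ℓ : ℕ, (hℓ : ℓ.Prime) → ℓ ∉ S → ℓ ≠ p → ℓ ≠ q₁ → ℓ ≠ q₂ → haveI : Fact ℓ.Prime := ⟨hℓ⟩;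
          parityHom ℓ (χ₁ x) = 0 ∧ parityHom ℓ (χ₂ x) = 0) ∧ _) ↔ _
    refine and_congr_left' (forall_congr' fun ℓ => forall_congr' fun hℓ => ?_)
    haveI : Fact ℓ.Prime := ⟨hℓ⟩
    rw [show parityHom ℓ (χ₁ x) = A ℓ x from rfl, show parityHom ℓ (χ₂ x) = B ℓ x from rfl, hA, hB]
  let V := Module.Dual (ZMod 2) N × N
  let Z : Submodule (ZMod 2) V := AddSubgroup.toZModSubmodule 2 (R.map β)
  have hmemZ : ∀ z : V, z ∈ Z ↔ ∃ x ∈ R, β x = z := fun z => by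
    rw [AddSubgroup.mem_toZModSubmodule, AddSubgroup.mem_map]
  /- ### (I) `Z` is totally isotropic: `f(n) = ∑_v Q_v = 0` on `R` -/
  have hpair : ∀ x : galH1Torsion E 2, (β x).1 (β x).2 =
      (KramerTwoDescent.signHom.comp χ₁ + KramerTwoDescent.signHom.comp χ₂) x * (KramerTwoDescent.signHom.comp χ₁) x +
        F₁ p x * B p x + F₂ p x * A p x + F₁ q₁ x * B q₁ x + F₂ q₁ x * A q₁ x + F₁ q₂ x * B q₂ x + F₂ q₂ x * A q₂ x := by
    intro x
    rw [hβ1, hβ2]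
    show (Pi.basisFun (ZMod 2) (Fin 7)).toDual (cPart x) (nPart x) = _
    rw [toDual_basisFun_apply, Fin.sum_univ_seven]
    rfl
  have hiso : ∀ z ∈ Z, z.1 z.2 = 0 := by
    intro z hz
    obtain ⟨x, hxR, rfl⟩ := (hmemZ z).mp hz
    obtain ⟨hsupp, hloc⟩ := (hmemR x).mp hxR
    have hout := sum_descentFormBits_out_eq_zero E S h h2S hgood hpS hq₁S hq₂S hpq₁ hpq₂ hne hp4 hq₁4 hq₂4
      (comp x).1 (comp x).2 (hcomp1 x) (hcomp2 x) hsupp hloc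
    have hD2 : signBit ((e₂ - e₁) * (e₂ - e₃)) = 1 := by
      rw [signBit, if_pos (mul_neg_of_pos_of_neg (by linarith) (by linarith))]
    have hD1 : signBit ((e₁ - e₂) * (e₁ - e₃)) = 0 :=
      (signBit_eq_zero_iff (mul_ne_zero (by linarith) (by linarith))).mpr
        (mul_pos_of_neg_of_neg (by linarith) (by linarith))
    rw [hD2, hD1] at hout
    rw [hpair, hSS, hS₁, hA, hA, hA, hB, hB, hB, hF₁, hF₁, hF₁, hF₂, hF₂, hF₂]
    linear_combination bitsum_infty (signBit ((comp x).1 : ℚ)) (signBit ((comp x).2 : ℚ)) +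
      bitsum_pair (parityBit p ((comp x).1 : ℚ)) (parityBit p ((comp x).2 : ℚ)) (qrBit p ((comp x).1 : ℚ))
        (qrBit p ((comp x).2 : ℚ)) _ _ (qrBit p ((e₁ - e₂) * (e₁ - e₃))) (qrBit p ((e₂ - e₁) * (e₂ - e₃)))
        (kappa_add_kappa' (d := d) hp4 h.ne₁₂) +
      bitsum_pair (parityBit q₁ ((comp x).1 : ℚ)) (parityBit q₁ ((comp x).2 : ℚ)) (qrBit q₁ ((comp x).1 : ℚ))
        (qrBit q₁ ((comp x).2 : ℚ)) _ _ (qrBit q₁ ((e₁ - e₂) * (e₁ - e₃))) (qrBit q₁ ((e₂ - e₁) * (e₂ - e₃)))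
        (kappa_add_kappa' (d := d) hq₁4 h.ne₁₂) +
      bitsum_pair (parityBit q₂ ((comp x).1 : ℚ)) (parityBit q₂ ((comp x).2 : ℚ)) (qrBit q₂ ((comp x).1 : ℚ))
        (qrBit q₂ ((comp x).2 : ℚ)) _ _ (qrBit q₂ ((e₁ - e₂) * (e₁ - e₃))) (qrBit q₂ ((e₂ - e₁) * (e₂ - e₃)))
        (kappa_add_kappa' (d := d) hq₂4 h.ne₁₂) + hout
  /- ### (II) `n = 0 ⟺ Selmer for E`; `f = 0 ⟺ the frame conditions of E^{(d)}`; `β` is injective on `R` -/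
  have hn_iff : ∀ x : galH1Torsion E 2, (β x).2 = 0 ↔ signBit ((comp x).1 : ℚ) = 0 ∧
      parityBit p ((comp x).2 : ℚ) = 0 ∧ parityBit p ((comp x).1 : ℚ) = 0 ∧
      parityBit q₁ ((comp x).2 : ℚ) = 0 ∧ parityBit q₁ ((comp x).1 : ℚ) = 0 ∧
      parityBit q₂ ((comp x).2 : ℚ) = 0 ∧ parityBit q₂ ((comp x).1 : ℚ) = 0 := by
    intro x
    rw [hβ2, vec7_eq_zero_iff]
    show ((KramerTwoDescent.signHom.comp χ₁) x = 0 ∧ B p x = 0 ∧ A p x = 0 ∧ B q₁ x = 0 ∧ A q₁ x = 0 ∧ B q₂ x = 0 ∧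
      A q₂ x = 0) ↔ _
    rw [hS₁, hA, hA, hA, hB, hB, hB]
  have hf_iff : ∀ x : galH1Torsion E 2, (β x).1 = 0 ↔ signBit ((comp x).1 : ℚ) + signBit ((comp x).2 : ℚ) = 0 ∧
      F₁ p x = 0 ∧ F₂ p x = 0 ∧ F₁ q₁ x = 0 ∧ F₂ q₁ x = 0 ∧ F₁ q₂ x = 0 ∧ F₂ q₂ x = 0 := by
    intro x
    rw [hβ1, ← map_zero toD, htoD_inj.eq_iff, vec7_eq_zero_iff]
    show ((KramerTwoDescent.signHom.comp χ₁ + KramerTwoDescent.signHom.comp χ₂) x = 0 ∧ F₁ p x = 0 ∧ F₂ p x = 0 ∧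
      F₁ q₁ x = 0 ∧ F₂ q₁ x = 0 ∧ F₁ q₂ x = 0 ∧ F₂ q₂ x = 0) ↔ _
    rw [hSS]
  -- the `I₀*` relations at `q` in terms of `F₁ q, F₂ q`
  have hrel_iff : ∀ (q : ℕ) [Fact q.Prime] (x : galH1Torsion E 2), (F₁ q x = 0 ∧ F₂ q x = 0) ↔
      (qrBit q ((comp x).1 : ℚ) = parityBit q ((comp x).1 : ℚ) * (qrBit q d + qrBit q (e₂ - e₁)) +
          parityBit q ((comp x).2 : ℚ) * qrBit q ((e₁ - e₂) * (e₁ - e₃)) ∧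
        qrBit q ((comp x).2 : ℚ) = parityBit q ((comp x).1 : ℚ) * qrBit q ((e₂ - e₁) * (e₂ - e₃)) +
          parityBit q ((comp x).2 : ℚ) * (qrBit q d + qrBit q (e₁ - e₂))) := by
    intro q _ x
    rw [hF₁, hF₂]
    exact rel_iff _ _ _ _ _ _ _ _
  have hSel_iff : ∀ x : galH1Torsion E 2, x ∈ selmerGroup E 2 ↔ x ∈ R ∧ (β x).2 = 0 := by
    intro x
    rw [mem_selmerGroup_iff_frame E S h h2S h12 h23 hgood hN (comp x).1 (comp x).2 (hcomp1 x) (hcomp2 x), hmemR, hn_iff]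
    constructor
    · rintro ⟨hsupp, hloc, hsign⟩
      exact ⟨⟨fun ℓ hℓ hℓS _ _ _ => hsupp ℓ hℓ hℓS, hloc⟩, hsign, (hsupp p hp.out hpS).2, (hsupp p hp.out hpS).1,
        (hsupp q₁ hq₁.out hq₁S).2, (hsupp q₁ hq₁.out hq₁S).1, (hsupp q₂ hq₂.out hq₂S).2, (hsupp q₂ hq₂.out hq₂S).1⟩
    · rintro ⟨⟨hsupp, hloc⟩, hsign, bp, ap, b1, a1, b2, a2⟩
      refine ⟨fun ℓ hℓ hℓS => ?_, hloc, hsign⟩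
      by_cases e0 : ℓ = p
      · subst e0; exact ⟨ap, bp⟩
      by_cases e1 : ℓ = q₁
      · subst e1; exact ⟨a1, b1⟩
      by_cases e2 : ℓ = q₂
      · subst e2; exact ⟨a2, b2⟩
      exact hsupp ℓ hℓ hℓS e0 e1 e2
  have hker : ∀ x ∈ R, β x = 0 → x = 0 := by
    intro x hxR hβx
    have hn0 : (β x).2 = 0 := by rw [hβx]; rfl
    have hf0 : (β x).1 = 0 := by rw [hβx]; rfl
    have hxSel : x ∈ selmerGroup E 2 := (hSel_iff x).mpr ⟨hxR, hn0⟩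
    obtain ⟨-, -, -, b1, a1, -, -⟩ := (hn_iff x).mp hn0
    obtain ⟨-, -, -, f1, f2, -, -⟩ := (hf_iff x).mp hf0
    rw [hF₁, a1, b1, mul_zero, mul_zero, add_zero, add_zero] at f1
    rw [hF₂, a1, b1, mul_zero, mul_zero, add_zero, add_zero] at f2
    exact E.eq_zero_of_mem_selmerGroup_of_qrBit_eq_zero h hrank hsha (qrBit_neg_one_eq_one_of_emod_four hq₁4) hδ₁₁ hδ₂₁
      hxSel (comp x).1 (comp x).2 (hcomp1 x) (hcomp2 x) f1 f2
  have hinj : Set.InjOn β R := by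
    intro x hx y hy hxy
    have := hker (x - y) (sub_mem hx hy) (by rw [map_sub, hxy, sub_self])
    exact sub_eq_zero.mp this
  /- ### (III) the three cardinalities -/
  haveI : Module.Finite (ZMod 2) V := inferInstance
  haveI : Finite V := Module.finite_of_finite (ZMod 2)
  have hfinN : finrank (ZMod 2) N = 7 := by
    rw [Module.finrank_fintype_fun_eq_card, Fintype.card_fin]
  -- `#Z = 2⁷`
  have hZcard : Nat.card Z = 2 ^ 7 := by
    apply le_antisymm
    · have h2 := two_mul_finrank_le_of_dualProd Z hiso
      rw [hfinN] at h2
      rw [Module.natCard_eq_pow_finrank (K := ZMod 2), Nat.card_zmod]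
      exact Nat.pow_le_pow_right two_pos (Nat.le_of_mul_le_mul_left h2 two_pos)
    · obtain ⟨X, hXcard, hX⟩ := exists_finset_relaxed E h S (S ∪ {p, q₁, q₂})
        (fun q hq => by
          rcases Finset.mem_union.mp hq with hq | hq
          · exact hS q hq
          · simp only [Finset.mem_insert, Finset.mem_singleton] at hq
            rcases hq with rfl | rfl | rfl
            exacts [hp.out, hq₁.out, hq₂.out])
        Finset.subset_union_left (m := 7) (by
          have : (S ∪ {p, q₁, q₂}).card = S.card + 3 := by
            rw [Finset.card_union_of_disjoint (Finset.disjoint_left.mpr fun a haS haT => by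
              simp only [Finset.mem_insert, Finset.mem_singleton] at haT
              rcases haT with rfl | rfl | rfl
              exacts [hpS haS, hq₁S haS, hq₂S haS]),
              Finset.card_insert_of_notMem (by simp [hpq₁, hpq₂]), Finset.card_insert_of_notMem (by simp [hne]),
              Finset.card_singleton]
          omega)
      have hXR : ∀ c ∈ X, c ∈ R := by
        intro c hc
        obtain ⟨h1, h2⟩ := hX c hc
        refine ⟨fun ℓ hℓ hℓS e0 e1 e2 => ?_, h2⟩
        haveI : Fact ℓ.Prime := ⟨hℓ⟩
        exact h1 ℓ (by simp [hℓS, e0, e1, e2])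
      let ι : X → Z := fun c => ⟨β c, (hmemZ _).mpr ⟨c, hXR c c.2, rfl⟩⟩
      have hι : Function.Injective ι := by
        intro c c' hcc'
        have := congrArg (fun z : Z => (z : V)) hcc'
        exact Subtype.ext (hinj (hXR c c.2) (hXR c' c'.2) this)
      calc 2 ^ 7 ≤ X.card := hXcard
        _ = Nat.card X := (Nat.card_eq_finsetCard X).symm
        _ ≤ Nat.card Z := Nat.card_le_card_of_injective ι hι
  -- `#(Z ∩ (N* × 0)) = #Sel⁽²⁾(E) = 4`
  have hZX : Nat.card ↥(Z ⊓ LinearMap.ker (LinearMap.snd (ZMod 2) (Module.Dual (ZMod 2) N) N)) = 4 := by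
    rw [← E.natCard_selmerGroup_two_eq_four h hrank hsha]
    symm
    refine Nat.card_congr (Equiv.ofBijective (fun c => ⟨β c, Submodule.mem_inf.mpr ⟨(hmemZ _).mpr
      ⟨c, ((hSel_iff c).mp c.2).1, rfl⟩, LinearMap.mem_ker.mpr ((hSel_iff c).mp c.2).2⟩⟩) ⟨fun c c' hcc' => ?_, fun z => ?_⟩)
    · have := congrArg (fun z : ↥(Z ⊓ LinearMap.ker (LinearMap.snd (ZMod 2) (Module.Dual (ZMod 2) N) N)) => (z : V)) hcc'
      exact Subtype.ext (hinj ((hSel_iff c).mp c.2).1 ((hSel_iff c').mp c'.2).1 this)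
    · obtain ⟨hzZ, hz0⟩ := Submodule.mem_inf.mp z.2
      obtain ⟨x, hxR, hx⟩ := (hmemZ _).mp hzZ
      have hn0 : (β x).2 = 0 := by rw [hx]; exact LinearMap.mem_ker.mp hz0
      exact ⟨⟨x, (hSel_iff x).mpr ⟨hxR, hn0⟩⟩, Subtype.ext hx⟩
  -- `#(Z ∩ (0 × N)) = #Sel⁽²⁾(E^{(d)})`
  have hZY : Nat.card ↥(Z ⊓ LinearMap.ker (LinearMap.fst (ZMod 2) (Module.Dual (ZMod 2) N) N)) =
      Nat.card (selmerGroup (E.quadraticTwist d) 2) := by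
    -- components of twisted classes and the transfer `c' ↦ c_E(a, b)`
    have hcomp' : ∀ c' : galH1Torsion (E.quadraticTwist d) 2, ∃ ab : ℚˣ × ℚˣ,
        kummerEquiv ℚ 2 ((E.quadraticTwist d).twoTorsionCharH1 h' c') = Additive.ofMul (QuotientGroup.mk ab.1) ∧
        kummerEquiv ℚ 2 ((E.quadraticTwist d).twoTorsionCharH1 h'.swap₁₂ c') = Additive.ofMul (QuotientGroup.mk ab.2) :=
      fun c' => by
        obtain ⟨a, b, ha, hb⟩ := (E.quadraticTwist d).exists_kummerEquiv_twoTorsionCharH1_pair_eq h' c'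
        exact ⟨(a, b), ha, hb⟩
    choose comp' hcomp'1 hcomp'2 using hcomp'
    -- the frame conditions of `x = c_E(a,b)` are those of the bits of `comp x`, which has the same classes
    have hcl : ∀ (a b : ℚˣ), (QuotientGroup.mk (comp (E.twoDescentClass h a b)).1 : SqUnits ℚ) = QuotientGroup.mk a ∧
        (QuotientGroup.mk (comp (E.twoDescentClass h a b)).2 : SqUnits ℚ) = QuotientGroup.mk b := fun a b =>
      ⟨Additive.ofMul.injective ((hcomp1 _).symm.trans (E.kummerEquiv_twoTorsionCharH1_twoDescentClass h a b)),
        Additive.ofMul.injective ((hcomp2 _).symm.trans (E.kummerEquiv_twoTorsionCharH1_swap_twoDescentClass h a b))⟩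
    -- forward map on `Sel⁽²⁾(E^{(d)})`
    have hfwd : ∀ c' ∈ selmerGroup (E.quadraticTwist d) 2,
        E.twoDescentClass h (comp' c').1 (comp' c').2 ∈ R ∧ (β (E.twoDescentClass h (comp' c').1 (comp' c').2)).1 = 0 := by
      intro c' hc'
      obtain ⟨hsupp, hloc, hrel, hsign⟩ := frame_of_twist_mem_selmerGroup E S h h12 h23 hgood hpS hq₁S hq₂S hpq₁ hpq₂
        hne hp8 hq₁4 hq₂4 hM8 hsplitp hsplitM hd hc' (comp' c').1 (comp' c').2 (hcomp'1 c') (hcomp'2 c')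
      set x := E.twoDescentClass h (comp' c').1 (comp' c').2 with hx
      obtain ⟨e1, e2⟩ := hcl (comp' c').1 (comp' c').2
      have hpb : ∀ (q : ℕ) [Fact q.Prime], parityBit q ((comp x).1 : ℚ) = parityBit q ((comp' c').1 : ℚ) ∧
          parityBit q ((comp x).2 : ℚ) = parityBit q ((comp' c').2 : ℚ) ∧
          qrBit q ((comp x).1 : ℚ) = qrBit q ((comp' c').1 : ℚ) ∧ qrBit q ((comp x).2 : ℚ) = qrBit q ((comp' c').2 : ℚ) :=
        fun q _ => ⟨parityBit_eq_of_mk_eq q e1, parityBit_eq_of_mk_eq q e2, qrBit_eq_of_mk_eq q e1, qrBit_eq_of_mk_eq q e2⟩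
      refine ⟨(hmemR x).mpr ⟨fun ℓ hℓ hℓS h1 h2 h3 => ?_, hloc⟩, (hf_iff x).mpr ⟨?_, ?_⟩⟩
      · haveI : Fact ℓ.Prime := ⟨hℓ⟩
        rw [(hpb ℓ).1, (hpb ℓ).2.1]; exact hsupp ℓ hℓ hℓS h1 h2 h3
      · rw [signBit_eq_of_mk_eq e1, signBit_eq_of_mk_eq e2, signBit_add_signBit_eq_zero_iff, hsign]
      · have hr : ∀ (q : ℕ) [Fact q.Prime], (q = p ∨ q = q₁ ∨ q = q₂) → F₁ q x = 0 ∧ F₂ q x = 0 := by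
          intro q _ hqT
          rw [hrel_iff, (hpb q).1, (hpb q).2.1, (hpb q).2.2.1, (hpb q).2.2.2]
          exact hrel q Fact.out hqT
        exact ⟨(hr p (Or.inl rfl)).1, (hr p (Or.inl rfl)).2, (hr q₁ (Or.inr (Or.inl rfl))).1,
          (hr q₁ (Or.inr (Or.inl rfl))).2, (hr q₂ (Or.inr (Or.inr rfl))).1, (hr q₂ (Or.inr (Or.inr rfl))).2⟩
    symm
    refine Nat.card_congr (Equiv.ofBijective (fun c' => ⟨β (E.twoDescentClass h (comp' c').1 (comp' c').2),
      Submodule.mem_inf.mpr ⟨(hmemZ _).mpr ⟨_, (hfwd c' c'.2).1, rfl⟩, LinearMap.mem_ker.mpr (hfwd c' c'.2).2⟩⟩)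
      ⟨fun c₁ c₂ hcc => ?_, fun z => ?_⟩)
    · -- injective
      have hv := congrArg (fun z : ↥(Z ⊓ LinearMap.ker (LinearMap.fst (ZMod 2) (Module.Dual (ZMod 2) N) N)) => (z : V)) hcc
      have hxx := hinj (hfwd c₁ c₁.2).1 (hfwd c₂ c₂.2).1 hv
      obtain ⟨e1, e2⟩ := hcl (comp' c₁).1 (comp' c₁).2
      obtain ⟨f1, f2⟩ := hcl (comp' c₂).1 (comp' c₂).2
      rw [hxx] at e1 e2
      have ha : (QuotientGroup.mk (comp' c₁).1 : SqUnits ℚ) = QuotientGroup.mk (comp' c₂).1 := e1.symm.trans f1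
      have hb : (QuotientGroup.mk (comp' c₁).2 : SqUnits ℚ) = QuotientGroup.mk (comp' c₂).2 := e2.symm.trans f2
      apply Subtype.ext
      rw [(E.quadraticTwist d).eq_twoDescentClass_of_kummerEquiv_eq h' _ _ (hcomp'1 c₁) (hcomp'2 c₁),
        (E.quadraticTwist d).eq_twoDescentClass_of_kummerEquiv_eq h' _ _ (hcomp'1 c₂) (hcomp'2 c₂)]
      exact (E.quadraticTwist d).twoDescentClass_eq_of_mk_eq h' ha hb
    · -- surjective
      obtain ⟨hzZ, hz0⟩ := Submodule.mem_inf.mp z.2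
      obtain ⟨x, hxR, hx⟩ := (hmemZ _).mp hzZ
      have hf0 : (β x).1 = 0 := by rw [hx]; exact LinearMap.mem_ker.mp hz0
      obtain ⟨hsupp, hloc⟩ := (hmemR x).mp hxR
      obtain ⟨s0, f1, f2, f3, f4, f5, f6⟩ := (hf_iff x).mp hf0
      have hx_eq : x = E.twoDescentClass h (comp x).1 (comp x).2 :=
        E.eq_twoDescentClass_of_kummerEquiv_eq h _ _ (hcomp1 x) (hcomp2 x)
      have hc'Sel : (E.quadraticTwist d).twoDescentClass h' (comp x).1 (comp x).2 ∈ selmerGroup (E.quadraticTwist d) 2 := by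
        refine twist_mem_selmerGroup_of_frame E S h h2S h12 h23 hgood hN hpS hq₁S hq₂S hpq₁ hpq₂ hne hp8 hq₁4 hq₂4 hM8
          hsplitp hsplitM hd (comp x).1 (comp x).2 hsupp (fun v hv => hx_eq ▸ hloc v hv) (fun q hq hqT => ?_)
          ((signBit_add_signBit_eq_zero_iff _ _).mp s0)
        haveI : Fact q.Prime := ⟨hq⟩
        rcases hqT with rfl | rfl | rfl
        · exact (hrel_iff _ x).mp ⟨f1, f2⟩
        · exact (hrel_iff _ x).mp ⟨f3, f4⟩
        · exact (hrel_iff _ x).mp ⟨f5, f6⟩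
      refine ⟨⟨_, hc'Sel⟩, Subtype.ext ?_⟩
      show β (E.twoDescentClass h (comp' _).1 (comp' _).2) = z
      rw [← hx]
      congr 1
      refine (E.twoDescentClass_eq_of_mk_eq h ?_ ?_).trans hx_eq.symm
      · exact Additive.ofMul.injective ((hcomp'1 _).symm.trans
          ((E.quadraticTwist d).kummerEquiv_twoTorsionCharH1_twoDescentClass h' _ _))
      · exact Additive.ofMul.injective ((hcomp'2 _).symm.trans
          ((E.quadraticTwist d).kummerEquiv_twoTorsionCharH1_swap_twoDescentClass h' _ _))
  /- ### (IV) KMR Prop. 2.4: `dim Sel(E) + dim Sel(E^d) + 7` is even -/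
  have hfZ : finrank (ZMod 2) Z = finrank (ZMod 2) N := by rw [hfinN]; exact finrank_eq_of_natCard_zmod_two hZcard
  have hfX : finrank (ZMod 2) ↥(Z ⊓ LinearMap.ker (LinearMap.snd (ZMod 2) (Module.Dual (ZMod 2) N) N)) = 2 :=
    finrank_eq_of_natCard_zmod_two (k := 2) (by rw [hZX]; norm_num)
  have hfY : finrank (ZMod 2) ↥(Z ⊓ LinearMap.ker (LinearMap.fst (ZMod 2) (Module.Dual (ZMod 2) N) N)) = 2 :=
    finrank_eq_of_natCard_zmod_two (k := 2) (by rw [hZY, h4]; norm_num)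
  have heven := even_finrank_inf_add_finrank_inf_add_of_dualProd Z hiso hfZ
  rw [hfX, hfY, hfinN] at heven
  exact absurd heven (by decide)

end Summit.BirchSwinnertonDyer.BirchSwinnertonDyer.Theorems.GenusKolyvaginAtTwo.TorsionCellD0

end
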